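import Mathlib
import Literature.Analysis.FluidPDE.Tao2016AveragedNS.BoundedEternalSolutions
import Summits.NavierStokesRegularity.NavierStokesRegularity.Theses.TaoLadderRungTwoBreak

/-!
# Crux `TaoLadderRungTwoBreak.NoSurvivingEternalViscBddOne` (stmt-NavierStokesRegularity-20419), stub (ρ0), DYADIC MEMBER /
# DSS STRATUM (⟨20205⟩ `stub_eternalLiouville`): the TERMINAL DRIFT of a discretely self-similar front in critical variables —
# (S₁)-SURVIVORS OVERSHOOT, the KOLMOGOROV front is the one whose stranded wake is in EQUILIBRIUM

MODEL lattice ODEs only (the positive Katz–Pavlović / Desnianskii–Novikov chain in Tao's critical variables,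
`V̇_n = Λ V_{n-1}² − Λ⁻¹ V_n V_{n+1}` on `t < 0`, `Λ = (1+ε₀)^{5/2}`, tree `…WakeDyadicClassical`, `…WakeDyadicKolmogorovEquilibrium`);
nothing in this file is a statement about the Navier–Stokes equations, and no stub, crux, rung or summit is proved by it
(`--supports stmt-NavierStokesRegularity-20419`).  DEF-FREE.

THE OBJECT.  A period-one discretely self-similar (DSS) solution of the critical chain is one with
`V_{n+1}(t) = κ V_n(κ t)` (`t < 0`) for a time-contraction ratio `κ > 0`; this is exactly what the tree's single-profile DSS wave
`W_n(σ) = Φ(σ − nT)` (`dssEmbed`, `q = 1`) becomes in the critical variable `V_n(t) = (−t)⁻¹ (W_n(−log(−t)))₀`, with `κ = e^{T}`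
(`crit_dssEmbed_scaling`).  Its terminal (stranded-wake) values `v_n = V_n(0⁻)` form the geometric profile `v_n = κⁿ v_0`
(`dss_terminal_succ`, `dss_terminal_natPow`), so the terminal regularity exponent of `…WakeDyadicRegularity` is `1 − log κ / log Λ` and
the (S₁) threshold `(1+ε₀)^{-4n} v_n² ↛ 0` reads `κ ≥ Λ^{4/5}`; in the tree's survival predicate, `Surviving 1 ε₀ T` forces
`Λ² < κ³` (`bigLam_sq_lt_exp_cube_of_surviving`).

THE DRIFT.  Along any solution with terminal values, the drive `V̇_n` has the terminal limit `Λ v_{n-1}² − Λ⁻¹ v_n v_{n+1}`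
(`drift_tendsto`); on a DSS solution this is `v_n² (Λ/κ² − κ/Λ)` (`dss_drift_tendsto`), whose sign is that of `Λ² − κ³`
(`drift_factor_neg_iff`, `drift_factor_pos_iff`, `drift_factor_eq_zero_iff`).  Hence:

* `dss_overshoot` — **SUPER-KOLMOGOROV FRONTS OVERSHOOT**: if `κ³ > Λ²` (in particular for every (S₁)-surviving DSS front,
  `κ ≥ Λ^{4/5}`), every lit shell approaches its stranded value STRICTLY FROM ABOVE: `v_n < V_n(t)` for all `t < 0` close to `0`
  (the shell is terminally decaying: drain `Λ⁻¹V_nV_{n+1}` beats feed `ΛV_{n-1}²` at the end);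
* `dss_undershoot` — sub-Kolmogorov fronts (`κ³ < Λ²`) approach from below;
* `dss_terminal_equilibrium_iff` — the stranded wake `(v_n)` of a DSS front with a lit shell is an EXACT EQUILIBRIUM of the chain
  (`Λ v_{n-1}² = Λ⁻¹ v_n v_{n+1}`, the Kolmogorov profile of `…WakeDyadicKolmogorovEquilibrium`) iff `κ³ = Λ²`, i.e. `κ = Λ^{2/3}`:
  the K41 front (numerically THE front of the dyadic member as the base tends to one, evidence F6 on ⟨20419⟩) is singled out as the
  one whose wake is born quasi-static; an (S₁)-survivor's wake is born draining.

READING for ⟨20419⟩/(ρ0) and ⟨20205⟩ (census of this hand).  A necessary signature of (S₁)-survival on the DSS stratum of the dyadic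
member: terminal overshoot on every shell.  The tree bounds overshoot only by the action factor `e^{M/Λ}` (`…WakeDyadicAncientApriori.
noOvershoot`); the hand's memo (evidence `W1-DSS-identities-memo-leafhand4-g24.md`) records why, at leading order in `log Λ`, the two
exact profile identities (terminal–action and energy–flux) put a flat stranded wake at `κ = Λ^{2/3}` and a maximally diffuse one at the
threshold `κ = Λ^{4/5}` — so the missing estimate of W1-dyadic|DSS is a quantitative OVERSHOOT (post-firing decay) bound, uniform as the
base tends to one.  HONEST LABEL: elementary real analysis (limits along `𝓝[<] 0`, strict monotonicity from a negative derivative);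
W1-dyadic, (ρ0), ⟨20419⟩, ⟨20205⟩ and every NS statement remain OPEN; rung 0.
-/

-- the summit and its single sub-problem share the name (CONVENTIONS §1)
set_option linter.dupNamespace false

namespace Summit.NavierStokesRegularity.NavierStokesRegularity.Theorems.NoSurvivingEternalViscBddOne.DSSTerminalDrift

open Filter Topology Set
open Literature.Analysis.FluidPDE.TaoCascade

/-! ## The drift factor `Λ/κ² − κ/Λ` and its sign -/

/-- `Λ/κ² − κ/Λ < 0 ↔ Λ² < κ³` (`Λ, κ > 0`). [folklore] -/
theorem drift_factor_neg_iff {Λ κ : ℝ} (hΛ : 0 < Λ) (hκ : 0 < κ) :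
    Λ / κ ^ 2 - κ / Λ < 0 ↔ Λ ^ 2 < κ ^ 3 := by
  rw [sub_neg, div_lt_div_iff₀ (pow_pos hκ 2) hΛ]
  constructor <;> intro h <;> nlinarith

/-- `0 < Λ/κ² − κ/Λ ↔ κ³ < Λ²` (`Λ, κ > 0`). [folklore] -/
theorem drift_factor_pos_iff {Λ κ : ℝ} (hΛ : 0 < Λ) (hκ : 0 < κ) :
    0 < Λ / κ ^ 2 - κ / Λ ↔ κ ^ 3 < Λ ^ 2 := by
  rw [sub_pos, div_lt_div_iff₀ hΛ (pow_pos hκ 2)]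
  constructor <;> intro h <;> nlinarith

/-- `Λ/κ² − κ/Λ = 0 ↔ κ³ = Λ²` (`Λ, κ > 0`): the drift factor vanishes exactly at the Kolmogorov ratio `κ = Λ^{2/3}`. [folklore] -/
theorem drift_factor_eq_zero_iff {Λ κ : ℝ} (hΛ : 0 < Λ) (hκ : 0 < κ) :
    Λ / κ ^ 2 - κ / Λ = 0 ↔ κ ^ 3 = Λ ^ 2 := by
  rw [sub_eq_zero, div_eq_div_iff (pow_pos hκ 2).ne' hΛ.ne']
  constructor <;> intro h <;> nlinarith

/-- At the Kolmogorov ratio the drift factor vanishes: `Λ/(Λ^{2/3})² − Λ^{2/3}/Λ = 0`. [folklore] -/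
theorem drift_factor_kolmogorov {Λ : ℝ} (hΛ : 0 < Λ) :
    Λ / (Λ ^ ((2 : ℝ) / 3)) ^ 2 - Λ ^ ((2 : ℝ) / 3) / Λ = 0 := by
  rw [drift_factor_eq_zero_iff hΛ (Real.rpow_pos_of_pos hΛ _)]
  rw [← Real.rpow_natCast (Λ ^ ((2 : ℝ) / 3)) 3, ← Real.rpow_mul hΛ.le]
  norm_num

/-- The (S₁) threshold lies in the overshoot regime: `1 < Λ` and `Λ^{4/5} ≤ κ` give `Λ² < κ³`. [folklore] -/
theorem sq_lt_cube_of_threshold {Λ κ : ℝ} (hΛ : 1 < Λ) (hκ : Λ ^ ((4 : ℝ) / 5) ≤ κ) : Λ ^ 2 < κ ^ 3 := by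
  have hΛ0 : 0 < Λ := by linarith
  have h45 : 0 < Λ ^ ((4 : ℝ) / 5) := Real.rpow_pos_of_pos hΛ0 _
  have hcube : (Λ ^ ((4 : ℝ) / 5)) ^ 3 ≤ κ ^ 3 := pow_le_pow_left₀ h45.le hκ 3
  have h125 : (Λ ^ ((4 : ℝ) / 5)) ^ 3 = Λ ^ ((12 : ℝ) / 5) := by
    rw [← Real.rpow_natCast (Λ ^ ((4 : ℝ) / 5)) 3, ← Real.rpow_mul hΛ0.le]
    norm_num
  have hlt : Λ ^ 2 < Λ ^ ((12 : ℝ) / 5) := by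
    rw [show Λ ^ 2 = Λ ^ ((2 : ℕ) : ℝ) from (Real.rpow_natCast Λ 2).symm]
    exact Real.rpow_lt_rpow_of_exponent_lt hΛ (by norm_num)
  rw [h125] at hcube
  exact lt_of_lt_of_le hlt hcube

/-! ## Terminal values of a DSS solution -/

/-- `t ↦ κt` maps `𝓝[<] 0` to `𝓝[<] 0` for `κ > 0`. [folklore] -/
theorem tendsto_mul_nhdsWithin_Iio_zero {κ : ℝ} (hκ : 0 < κ) :
    Tendsto (fun t : ℝ => κ * t) (𝓝[<] (0 : ℝ)) (𝓝[<] (0 : ℝ)) := by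
  have hc : ContinuousWithinAt (fun t : ℝ => κ * t) (Iio 0) 0 :=
    (continuous_const.mul continuous_id).continuousWithinAt
  have h := hc.tendsto_nhdsWithin (fun t (ht : t < 0) => show κ * t ∈ Iio (0 : ℝ) from mul_neg_of_pos_of_neg hκ ht)
  simpa only [mul_zero] using h

/-- **Terminal values of a DSS solution scale by `κ`**: `V_{n+1}(t) = κ V_n(κt)` on `t < 0` and `V_k → v_k` as `t ↑ 0` give
`v_{n+1} = κ v_n`. [elementary] -/
theorem dss_terminal_succ {κ : ℝ} {V : ℤ → ℝ → ℝ} {v : ℤ → ℝ} (hκ : 0 < κ)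
    (hdss : ∀ (n : ℤ) (t : ℝ), t < 0 → V (n + 1) t = κ * V n (κ * t))
    (hv : ∀ n : ℤ, Tendsto (V n) (𝓝[<] 0) (𝓝 (v n))) (n : ℤ) :
    v (n + 1) = κ * v n := by
  have h1 : Tendsto (fun t => κ * V n (κ * t)) (𝓝[<] 0) (𝓝 (κ * v n)) :=
    ((hv n).comp (tendsto_mul_nhdsWithin_Iio_zero hκ)).const_mul κ
  have h2 : Tendsto (V (n + 1)) (𝓝[<] 0) (𝓝 (κ * v n)) :=
    h1.congr' (eventually_nhdsWithin_of_forall fun t ht => (hdss n t ht).symm)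
  exact tendsto_nhds_unique (hv (n + 1)) h2

/-- Downward form: `v_{n-1} = κ⁻¹ v_n`. [elementary] -/
theorem dss_terminal_pred {κ : ℝ} {V : ℤ → ℝ → ℝ} {v : ℤ → ℝ} (hκ : 0 < κ)
    (hdss : ∀ (n : ℤ) (t : ℝ), t < 0 → V (n + 1) t = κ * V n (κ * t))
    (hv : ∀ n : ℤ, Tendsto (V n) (𝓝[<] 0) (𝓝 (v n))) (n : ℤ) :
    v (n - 1) = κ⁻¹ * v n := by
  have h := dss_terminal_succ hκ hdss hv (n - 1)
  rw [sub_add_cancel] at h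
  rw [h, inv_mul_cancel_left₀ hκ.ne']

/-- **The stranded wake of a DSS solution is geometric**: `v_n = κⁿ v_0` (`n ≥ 0`); its terminal regularity exponent in the sense
of `…WakeDyadicRegularity` is `1 − log κ/log Λ`. [elementary] -/
theorem dss_terminal_natPow {κ : ℝ} {V : ℤ → ℝ → ℝ} {v : ℤ → ℝ} (hκ : 0 < κ)
    (hdss : ∀ (n : ℤ) (t : ℝ), t < 0 → V (n + 1) t = κ * V n (κ * t))
    (hv : ∀ n : ℤ, Tendsto (V n) (𝓝[<] 0) (𝓝 (v n))) (n : ℕ) :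
    v n = κ ^ n * v 0 := by
  induction n with
  | zero => simp
  | succ k ih =>
    have h := dss_terminal_succ hκ hdss hv (k : ℤ)
    have e : ((k + 1 : ℕ) : ℤ) = (k : ℤ) + 1 := by push_cast; ring
    rw [e, h, ih, pow_succ]
    ring

/-! ## The terminal drift -/

/-- **Terminal drift of any solution with terminal values**: the drive `Λ V_{n-1}² − Λ⁻¹ V_n V_{n+1}` tends to
`Λ v_{n-1}² − Λ⁻¹ v_n v_{n+1}` as `t ↑ 0`. [elementary] -/
theorem drift_tendsto {Λ : ℝ} {V : ℤ → ℝ → ℝ} {v : ℤ → ℝ}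
    (hv : ∀ n : ℤ, Tendsto (V n) (𝓝[<] 0) (𝓝 (v n))) (n : ℤ) :
    Tendsto (fun t => Λ * V (n - 1) t ^ 2 - Λ⁻¹ * (V n t * V (n + 1) t)) (𝓝[<] 0)
      (𝓝 (Λ * v (n - 1) ^ 2 - Λ⁻¹ * (v n * v (n + 1)))) :=
  (((hv (n - 1)).pow 2).const_mul Λ).sub (((hv n).mul (hv (n + 1))).const_mul Λ⁻¹)

/-- **Terminal drift of a DSS solution**: `V̇_n → v_n² (Λ/κ² − κ/Λ)` as `t ↑ 0`. [elementary] -/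
theorem dss_drift_tendsto {Λ κ : ℝ} {V : ℤ → ℝ → ℝ} {v : ℤ → ℝ} (hΛ : 0 < Λ) (hκ : 0 < κ)
    (hdss : ∀ (n : ℤ) (t : ℝ), t < 0 → V (n + 1) t = κ * V n (κ * t))
    (hv : ∀ n : ℤ, Tendsto (V n) (𝓝[<] 0) (𝓝 (v n))) (n : ℤ) :
    Tendsto (fun t => Λ * V (n - 1) t ^ 2 - Λ⁻¹ * (V n t * V (n + 1) t)) (𝓝[<] 0)
      (𝓝 (v n ^ 2 * (Λ / κ ^ 2 - κ / Λ))) := by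
  have h := drift_tendsto (Λ := Λ) hv n
  have e : Λ * v (n - 1) ^ 2 - Λ⁻¹ * (v n * v (n + 1)) = v n ^ 2 * (Λ / κ ^ 2 - κ / Λ) := by
    rw [dss_terminal_pred hκ hdss hv n, dss_terminal_succ hκ hdss hv n]
    field_simp
  rw [e] at h
  exact h

/-- **The stranded wake of a DSS solution with a lit shell is an exact equilibrium of the chain iff `κ³ = Λ²`** (`κ = Λ^{2/3}`,
the Kolmogorov ratio): `Λ v_{n-1}² = Λ⁻¹ v_n v_{n+1} ↔ κ³ = Λ²` when `v_n ≠ 0`. [elementary] -/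
theorem dss_terminal_equilibrium_iff {Λ κ : ℝ} {V : ℤ → ℝ → ℝ} {v : ℤ → ℝ} (hΛ : 0 < Λ) (hκ : 0 < κ)
    (hdss : ∀ (n : ℤ) (t : ℝ), t < 0 → V (n + 1) t = κ * V n (κ * t))
    (hv : ∀ n : ℤ, Tendsto (V n) (𝓝[<] 0) (𝓝 (v n))) {n : ℤ} (hvn : v n ≠ 0) :
    Λ * v (n - 1) ^ 2 = Λ⁻¹ * (v n * v (n + 1)) ↔ κ ^ 3 = Λ ^ 2 := by
  have e : Λ * v (n - 1) ^ 2 - Λ⁻¹ * (v n * v (n + 1)) = v n ^ 2 * (Λ / κ ^ 2 - κ / Λ) := by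
    rw [dss_terminal_pred hκ hdss hv n, dss_terminal_succ hκ hdss hv n]
    field_simp
  rw [← sub_eq_zero, e, mul_eq_zero, or_iff_right (pow_ne_zero 2 hvn), drift_factor_eq_zero_iff hΛ hκ]

/-! ## Overshoot: a negative terminal drift means approach from above -/

/-- **Real-analysis core.**  A function differentiable on `t < 0` whose derivative tends to a NEGATIVE limit as `t ↑ 0` and which
tends to `ℓ` there, lies STRICTLY ABOVE `ℓ` for all `t < 0` close to `0`. [folklore] -/
theorem eventually_gt_of_deriv_tendsto_neg {f : ℝ → ℝ} {D : ℝ → ℝ} {d ℓ : ℝ}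
    (hf : ∀ t : ℝ, t < 0 → HasDerivAt f (D t) t) (hD : Tendsto D (𝓝[<] 0) (𝓝 d)) (hd : d < 0)
    (hℓ : Tendsto f (𝓝[<] 0) (𝓝 ℓ)) : ∀ᶠ t in 𝓝[<] (0 : ℝ), ℓ < f t := by
  -- the derivative is eventually negative: on some `(t₀, 0)`
  have hev : ∀ᶠ t in 𝓝[<] (0 : ℝ), D t < 0 := hD.eventually (gt_mem_nhds hd)
  obtain ⟨t₀, ht₀, hneg⟩ : ∃ t₀ < (0 : ℝ), ∀ t, t₀ < t → t < 0 → D t < 0 := by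
    rcases (mem_nhdsLT_iff_exists_Ioo_subset).1 hev with ⟨t₀, ht₀, hsub⟩
    exact ⟨t₀, ht₀, fun t h1 h2 => hsub ⟨h1, h2⟩⟩
  -- `f` is strictly decreasing on `(t₀, 0)`
  have hanti : StrictAntiOn f (Ioo t₀ 0) := by
    refine strictAntiOn_of_deriv_neg (convex_Ioo t₀ 0) ?_ ?_
    · exact fun t ht => (hf t ht.2).continuousAt.continuousWithinAt
    · intro t ht
      rw [interior_Ioo] at ht
      rw [(hf t ht.2).deriv]
      exact hneg t ht.1 ht.2
  -- hence `ℓ ≤ f s < f t` for `t₀ < t < s < 0`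
  have hmem : Ioo t₀ (0 : ℝ) ∈ 𝓝[<] (0 : ℝ) := Ioo_mem_nhdsLT ht₀
  filter_upwards [hmem] with t ht
  obtain ⟨s, hts, hs0⟩ : ∃ s, t < s ∧ s < (0 : ℝ) := ⟨t / 2, by linarith [ht.2], by linarith [ht.2]⟩
  have hs : s ∈ Ioo t₀ 0 := ⟨lt_trans ht.1 hts, hs0⟩
  have hlt : f s < f t := hanti ht hs hts
  have hle : ℓ ≤ f s := by
    refine le_of_tendsto hℓ ?_
    have hmem' : Ioo s (0 : ℝ) ∈ 𝓝[<] (0 : ℝ) := Ioo_mem_nhdsLT hs0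
    filter_upwards [hmem'] with u hu
    exact (hanti hs ⟨lt_trans hs.1 hu.1, hu.2⟩ hu.1).le
  exact lt_of_le_of_lt hle hlt

/-- Mirror image: a POSITIVE terminal drift means approach strictly from below. [folklore] -/
theorem eventually_lt_of_deriv_tendsto_pos {f : ℝ → ℝ} {D : ℝ → ℝ} {d ℓ : ℝ}
    (hf : ∀ t : ℝ, t < 0 → HasDerivAt f (D t) t) (hD : Tendsto D (𝓝[<] 0) (𝓝 d)) (hd : 0 < d)
    (hℓ : Tendsto f (𝓝[<] 0) (𝓝 ℓ)) : ∀ᶠ t in 𝓝[<] (0 : ℝ), f t < ℓ := by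
  have h := eventually_gt_of_deriv_tendsto_neg (f := fun t => -f t) (D := fun t => -D t) (d := -d) (ℓ := -ℓ)
    (fun t ht => (hf t ht).neg) hD.neg (neg_neg_of_pos hd) hℓ.neg
  filter_upwards [h] with t ht
  linarith

/-- `x ≠ 0 → 0 < x²`. [folklore] -/
theorem sq_pos_of_ne_zero' {x : ℝ} (hx : x ≠ 0) : 0 < x ^ 2 :=
  lt_of_le_of_ne (sq_nonneg x) (Ne.symm (pow_ne_zero 2 hx))

/-- **SUPER-KOLMOGOROV DSS FRONTS OVERSHOOT.**  On a DSS solution of the critical chain with `κ³ > Λ²`, every lit shell (`v_n ≠ 0`)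
approaches its stranded value strictly from above: `v_n < V_n(t)` for all `t < 0` close to `0` (terminally the drain beats the feed).
By `sq_lt_cube_of_threshold` this covers every (S₁)-surviving DSS front (`κ ≥ Λ^{4/5}`, `Λ > 1`).
[cite: Tao2016AveragedNS, §1.2, §4 Lemma 4.1 (4.8), §6.4 (the scalar chain in self-similar variables); elementary] -/
theorem dss_overshoot {ε₀ κ : ℝ} {V : ℤ → ℝ → ℝ} {v : ℤ → ℝ} (hε : 0 < ε₀) (hκ : 0 < κ)
    (hV : ∀ (n : ℤ) (t : ℝ), t < 0 →
      HasDerivAt (V n) (bigLam ε₀ * V (n - 1) t ^ 2 - (bigLam ε₀)⁻¹ * (V n t * V (n + 1) t)) t)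
    (hdss : ∀ (n : ℤ) (t : ℝ), t < 0 → V (n + 1) t = κ * V n (κ * t))
    (hv : ∀ n : ℤ, Tendsto (V n) (𝓝[<] 0) (𝓝 (v n)))
    (hsuper : bigLam ε₀ ^ 2 < κ ^ 3) {n : ℤ} (hvn : v n ≠ 0) :
    ∀ᶠ t in 𝓝[<] (0 : ℝ), v n < V n t := by
  have hΛ : 0 < bigLam ε₀ := bigLam_pos (by linarith)
  have hfac : bigLam ε₀ / κ ^ 2 - κ / bigLam ε₀ < 0 := (drift_factor_neg_iff hΛ hκ).2 hsuper
  have hd : v n ^ 2 * (bigLam ε₀ / κ ^ 2 - κ / bigLam ε₀) < 0 :=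
    mul_neg_of_pos_of_neg (sq_pos_of_ne_zero' hvn) hfac
  exact eventually_gt_of_deriv_tendsto_neg (hV n) (dss_drift_tendsto hΛ hκ hdss hv n) hd (hv n)

/-- **SUB-KOLMOGOROV DSS FRONTS UNDERSHOOT**: if `κ³ < Λ²`, every lit shell approaches its stranded value strictly from below.
[cite: Tao2016AveragedNS, §1.2, §4 Lemma 4.1 (4.8), §6.4; elementary] -/
theorem dss_undershoot {ε₀ κ : ℝ} {V : ℤ → ℝ → ℝ} {v : ℤ → ℝ} (hε : 0 < ε₀) (hκ : 0 < κ)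
    (hV : ∀ (n : ℤ) (t : ℝ), t < 0 →
      HasDerivAt (V n) (bigLam ε₀ * V (n - 1) t ^ 2 - (bigLam ε₀)⁻¹ * (V n t * V (n + 1) t)) t)
    (hdss : ∀ (n : ℤ) (t : ℝ), t < 0 → V (n + 1) t = κ * V n (κ * t))
    (hv : ∀ n : ℤ, Tendsto (V n) (𝓝[<] 0) (𝓝 (v n)))
    (hsub : κ ^ 3 < bigLam ε₀ ^ 2) {n : ℤ} (hvn : v n ≠ 0) :
    ∀ᶠ t in 𝓝[<] (0 : ℝ), V n t < v n := by
  have hΛ : 0 < bigLam ε₀ := bigLam_pos (by linarith)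
  have hfac : 0 < bigLam ε₀ / κ ^ 2 - κ / bigLam ε₀ := (drift_factor_pos_iff hΛ hκ).2 hsub
  have hd : 0 < v n ^ 2 * (bigLam ε₀ / κ ^ 2 - κ / bigLam ε₀) := mul_pos (sq_pos_of_ne_zero' hvn) hfac
  exact eventually_lt_of_deriv_tendsto_pos (hV n) (dss_drift_tendsto hΛ hκ hdss hv n) hd (hv n)

/-- **(S₁)-SURVIVING DSS FRONTS OVERSHOOT ON EVERY LIT SHELL** (threshold form: `κ ≥ Λ^{4/5}`).
[cite: Tao2016AveragedNS, §1.2, §4 Lemma 4.1 (4.8) and the viscous equation before Thm. 4.2, §6.4; elementary] -/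
theorem dss_overshoot_of_threshold {ε₀ κ : ℝ} {V : ℤ → ℝ → ℝ} {v : ℤ → ℝ} (hε : 0 < ε₀)
    (hV : ∀ (n : ℤ) (t : ℝ), t < 0 →
      HasDerivAt (V n) (bigLam ε₀ * V (n - 1) t ^ 2 - (bigLam ε₀)⁻¹ * (V n t * V (n + 1) t)) t)
    (hdss : ∀ (n : ℤ) (t : ℝ), t < 0 → V (n + 1) t = κ * V n (κ * t))
    (hv : ∀ n : ℤ, Tendsto (V n) (𝓝[<] 0) (𝓝 (v n)))
    (hκ : bigLam ε₀ ^ ((4 : ℝ) / 5) ≤ κ) {n : ℤ} (hvn : v n ≠ 0) :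
    ∀ᶠ t in 𝓝[<] (0 : ℝ), v n < V n t := by
  have hΛ1 : 1 < bigLam ε₀ := Real.one_lt_rpow (by linarith) (by norm_num)
  have hκ0 : 0 < κ := lt_of_lt_of_le (Real.rpow_pos_of_pos (by linarith) _) hκ
  exact dss_overshoot hε hκ0 hV hdss hv (sq_lt_cube_of_threshold hΛ1 hκ) hvn

/-! ## Dictionary to the tree's DSS waves and survival predicate -/

/-- **The tree's survival window lies in the overshoot regime**: `Surviving 1 ε₀ T` (`(1+ε₀)^{-1} ≤ e^{2T}/(1+ε₀)^5 < 1`) gives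
`Λ² = (1+ε₀)^5 < e^{3T}` — with `κ = e^{T}` the critical-variable contraction ratio of the wave, `κ³ > Λ²`.
[cite: Tao2016AveragedNS, §4 (the viscous equation before Thm. 4.2), §6.4; cell vocabulary `Surviving`, `dssMu`, `bigLam`] -/
theorem bigLam_sq_lt_exp_cube_of_surviving {ε₀ T : ℝ} (hε : 0 < ε₀) (hS : Surviving 1 ε₀ T) :
    bigLam ε₀ ^ 2 < Real.exp T ^ 3 := by
  obtain ⟨hlo, -⟩ := hS
  have h1 : 0 < 1 + ε₀ := by linarith
  have h5 : 0 < (1 + ε₀) ^ 5 := pow_pos h1 5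
  -- `e^{2T} ≥ (1+ε₀)^4`
  have h4 : (1 + ε₀) ^ 4 ≤ Real.exp (2 * T) := by
    unfold dssMu at hlo
    rw [le_div_iff₀ h5] at hlo
    have e : (1 + ε₀) ^ (-(1 : ℝ)) * (1 + ε₀) ^ 5 = (1 + ε₀) ^ 4 := by
      rw [Real.rpow_neg h1.le, Real.rpow_one]
      field_simp
    rw [e] at hlo
    exact hlo
  -- `e^{T} ≥ (1+ε₀)^2`
  have h2 : (1 + ε₀) ^ 2 ≤ Real.exp T := by
    have hsq : ((1 + ε₀) ^ 2) ^ 2 ≤ Real.exp T ^ 2 := by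
      rw [← pow_mul, ← Real.exp_nat_mul]
      push_cast
      simpa using h4
    exact (pow_le_pow_iff_left₀ (pow_nonneg h1.le 2) (Real.exp_pos T).le two_ne_zero).1 hsq
  have h6 : (1 + ε₀) ^ 6 ≤ Real.exp T ^ 3 := by
    have := pow_le_pow_left₀ (pow_nonneg h1.le 2) h2 3
    rw [← pow_mul] at this
    exact this
  have h56 : (1 + ε₀) ^ 5 < (1 + ε₀) ^ 6 := pow_lt_pow_right₀ (by linarith) (by norm_num)
  rw [bigLam_sq hε.le]
  exact lt_of_lt_of_le h56 h6

/-- **Single-profile DSS waves are DSS solutions in critical variables with `κ = e^{T}`.**  For the eternal solution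
`W = dssEmbed perm T Φ r₀` carried by ONE profile (`ρ = Fin 1`), the critical variable `V_n(t) = (−t)⁻¹ (W_n(−log(−t)))_i` satisfies
`V_{n+1}(t) = e^{T} V_n(e^{T} t)` for every `t < 0` and every component `i`.
[cite: Tao2016AveragedNS, §4 Lemma 4.1 (4.8), §6.4 (self-similar variables); cell vocabulary `dssEmbed`] -/
theorem crit_dssEmbed_scaling {m : ℕ} (perm : Equiv.Perm (Fin 1)) (T : ℝ) (Φ : Fin 1 → ℝ → Em m) (r₀ : Fin 1)
    (i : Fin m) (n : ℤ) {t : ℝ} (ht : t < 0) :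
    (-t)⁻¹ * (dssEmbed perm T Φ r₀ (n + 1) (-Real.log (-t))) i
      = Real.exp T * ((-(Real.exp T * t))⁻¹ * (dssEmbed perm T Φ r₀ n (-Real.log (-(Real.exp T * t)))) i) := by
  have hE : 0 < Real.exp T := Real.exp_pos T
  have hnt : 0 < -t := by linarith
  have hr : ∀ r : Fin 1, r = r₀ := fun r => Subsingleton.elim r r₀
  unfold dssEmbed
  rw [hr ((perm ^ (n + 1)) r₀), hr ((perm ^ n) r₀)]
  have hlog : -Real.log (-(Real.exp T * t)) - (n : ℝ) * T = -Real.log (-t) - ((n + 1 : ℤ) : ℝ) * T := by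
    rw [show -(Real.exp T * t) = Real.exp T * (-t) by ring, Real.log_mul hE.ne' hnt.ne', Real.log_exp]
    push_cast
    ring
  rw [hlog]
  have hinv : Real.exp T * (-(Real.exp T * t))⁻¹ = (-t)⁻¹ := by
    rw [show -(Real.exp T * t) = Real.exp T * (-t) by ring, mul_inv, ← mul_assoc, mul_inv_cancel₀ hE.ne', one_mul]
  rw [← mul_assoc, hinv]

end Summit.NavierStokesRegularity.NavierStokesRegularity.Theorems.NoSurvivingEternalViscBddOne.DSSTerminalDrift
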